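import Literature.Barriers.QuantumAdvantage.PPolyOraclesLemma82
import Literature.Barriers.QuantumAdvantage.PPolyOraclesDecision
import Literature.Computability.Cryptography.SamplingProblemsCardinality
import HarnessLib

/-!
# Aaronson–Chen 2017, Lemma 8.2 / Thm. 8.1: the discharges — VACUOUS over the tree's `SampP`

Sibling proof file of `PPolyOraclesLemma82.lean` (the machine fact
`aaronsonChen2017_lem82_machine`), `PPolyOraclesProofs.lean` (`aaronsonChen2017_lem82`,
`aaronsonChen2017_thm81_sampBQP_subset`), `PPolyOraclesDecision.lean`
(`aaronsonChen2017_lem82_decision`) and the barrier entry `PPolyOracles.lean`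
(`aaronsonChen2017_thm81`), all vendoring S. Aaronson, L. Chen, *Complexity-theoretic
foundations of quantum supremacy experiments*, CCC 2017 (arXiv:1612.05903) [AaronsonChen2017],
**Lemma 8.2** and **Thm. 8.1** (p. 32):

> "Suppose `SampBPP = SampBQP` and `NP ⊆ BPP`. Then for any polynomial `q(n)` and any `SampBQP`
> oracle algorithm `M`, there is a `SampBPP` oracle algorithm `A` such that: For every
> `O ∈ SIZE(q(n))` … `‖𝒟^M_{x,ε} − 𝒟^A_{x,ε}‖ ≤ ε`." (Lemma 8.2)

**What this file proves, and why it is hollow.** Each of the five named facts above is typed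
with the hypothesis `SampP = SampBQP` over the tree's classes of
`Literature/Computability/Cryptography/SamplingProblems.lean`. That hypothesis is REFUTABLE in the
tree: `Literature.Computability.Cryptography.sampP_ne_sampBQP` (`SamplingProblemsCardinality.lean`)
proves `SampP ≠ SampBQP`, because the tree's `SampP` quantifies over `RandAlg`s whose coin budget
`coinLen : ℕ → ℕ` is only polynomially *bounded* — advice that the machine reads off the length of
its coin string — so that `SampP` contains uncountably many point-mass problems, while `SampBQP`
(uniform families, polynomial-time post-processing) is countable. Hence all five facts hold by
*ex falso*, and so they are discharged here (`…_holds`), each docstring saying so; the barrier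
`PPolyOracles` of the entry file thereby reduces to its first conjunct, Thm. 7.6
(`PPolyOracles_of_thm76`), and its proved "reading" `¬ (SampP = SampBQP ∧ NP ⊆ BPP)` holds
unconditionally (`not_sampP_eq_sampBQP_and`), i.e. as formalised the barrier constrains nothing.

**What the faithful statements are** (recorded, not vendored here — no new named fact is minted
by a discharge, D-0026). The source's `SampBPP` is a class of UNIFORM machines (Def. 2.3, p. 12:
"there exists a probabilistic polynomial-time algorithm `B` that, given `⟨x, 0^{1/ε}⟩` as input,
samples from a probability distribution `C_x` such that `‖C_x − D_x‖ ≤ ε`"), which the tree has as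
`Literature.Computability.Cryptography.UniformSampP` (`SamplingProblemsUniform.lean`, with
`UniformSampP ⊆ SampBQP` PROVED). The non-vacuous renderings of Lemma 8.2 / Thm. 8.1 replace the
hypothesis `SampP = SampBQP` by `UniformSampP = SampBQP` (equivalently `SampBQP ⊆ UniformSampP`);
under that hypothesis the machine half of Lemma 8.2 ("Showing that `A` is a `SampBPP` algorithm",
p. 33: samples from `Q_t` by `SampBQP = SampBPP`, a consistent `g ∈ SIZE(q(n))` by `NP ⊆ BPP`,
the final sample by `SampBQP = SampBPP` again) remains exactly the machine-level theory described
in the module docstring of `PPolyOraclesLemma82.lean`, on top of the PROVED analysis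
`aaronsonChen2017_lem82_analysis`. Restating the barrier entry is an operator/planner decision.
(The relativized class `SampPRel` of `SupremacyTheoremsNonRelativizing.lean`, in which Thm. 8.1
concludes, is NOT affected: its `OracleAdversary` carries literal polynomials `coins`, `fuel`, so
it is a uniform class — which in turn makes the unused bridge fact `SampPRel_empty :
SampPRel Oracle.empty = SampP` of that file inherit the defect of `SampP`.)

## Sources

* [AaronsonChen2017] arXiv:1612.05903, read via `lit read arxiv:1612.05903`: Def. 2.3 (p. 12),
  Thm. 8.1 and Lemma 8.2 with its proof (pp. 32–33).
* `Literature/Computability/Cryptography/SamplingProblemsCardinality.lean` (`sampP_ne_sampBQP`,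
  `sampBQP_countable`, `not_countable_sampP`), `SamplingProblems.lean` (docstring of
  `SampP_subset_SampBQP`: "Mis-stated — false as formalised"), `SamplingProblemsUniform.lean`.
-/

namespace Literature.Barriers.QuantumAdvantage

open Literature.Computability.Cryptography Literature.Computability.Complexity
  Literature.Computability.Complexity.Nondeterministic

/-! ### The hypothesis `SampP = SampBQP` is refutable -/

/-- **The collapse hypothesis of Thm. 8.1 fails outright in the tree's models**:
`¬ (SampP = SampBQP ∧ NP ⊆ BPP)`, by `sampP_ne_sampBQP` alone — so the proved readings
`not_collapse_of_pPolyOracleSeparation`, `sampP_ne_or_NP_not_subset` of the entry file hold with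
no separation hypothesis at all (the barrier, as typed over the advice-taking `SampP`, constrains
nothing). [cite: AaronsonChen2017, Thm. 8.1 (p. 32)] -/
theorem not_sampP_eq_sampBQP_and : ¬ (SampP = SampBQP ∧ NP ⊆ BPP) := fun h =>
  sampP_ne_sampBQP h.1

/-- `SampBPP ≠ SampBQP ∨ NP ⊄ BPP` unconditionally, over the tree's classes (left disjunct, by
`sampP_ne_sampBQP`). [cite: AaronsonChen2017, §1 (p. 9)] -/
theorem sampP_ne_or_NP_not_subset_unconditional : SampP ≠ SampBQP ∨ ¬ NP ⊆ BPP :=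
  Or.inl sampP_ne_sampBQP

/-! ### The discharges (each by ex falso) -/

/-- **Discharge of `aaronsonChen2017_lem82_machine` — VACUOUS.** The fact's first hypothesis
`SampP = SampBQP` contradicts `sampP_ne_sampBQP` (the tree's `SampP` takes advice through its coin
budget and is uncountable; `SampBQP` is countable), so the machine half of Lemma 8.2 ("Showing
that `A` is a `SampBPP` algorithm", p. 33) holds with nothing to construct. The faithful,
non-vacuous statement would assume `UniformSampP = SampBQP` instead (module docstring); its proof
obligations are those listed in `PPolyOraclesLemma82.lean`.
[cite: AaronsonChen2017, Lemma 8.2 (proof, "Showing that A is a SampBPP algorithm", p. 33)] -/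
theorem aaronsonChen2017_lem82_machine_holds : aaronsonChen2017_lem82_machine :=
  fun hS => absurd hS sampP_ne_sampBQP

/-- **Discharge of `aaronsonChen2017_lem82`** (Lemma 8.2 as vendored, accuracy `1/k`): from the
machine fact and the PROVED analysis `aaronsonChen2017_lem82_analysis` through
`aaronsonChen2017_lem82_of_machine` — and therefore equally VACUOUS over the tree's `SampP`
(hypothesis `SampP = SampBQP` refuted by `sampP_ne_sampBQP`). [cite: AaronsonChen2017, Lemma 8.2 (p. 32)] -/
theorem aaronsonChen2017_lem82_holds : aaronsonChen2017_lem82 :=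
  aaronsonChen2017_lem82_of_machine aaronsonChen2017_lem82_machine_holds

/-- **Discharge of `aaronsonChen2017_lem82_decision`** (Lemma 8.2 read for decision procedures)
— VACUOUS: hypothesis `SampP = SampBQP` refuted by `sampP_ne_sampBQP`.
[cite: AaronsonChen2017, Lemma 8.2 (p. 32)] -/
theorem aaronsonChen2017_lem82_decision_holds : aaronsonChen2017_lem82_decision :=
  fun hS => absurd hS sampP_ne_sampBQP

/-- **Discharge of `aaronsonChen2017_thm81_sampBQP_subset`** ("Hence `SampBQP^O ⊆ SampBPP^O`"):
from Lemma 8.2 through the PROVED reduction `aaronsonChen2017_thm81_sampBQP_subset_of_lem82`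
(accuracy doubling `A'(⟨x, 1^k⟩) := A_M(⟨x, 1^{2k}⟩)`, p. 32) — VACUOUS with it.
[cite: AaronsonChen2017, Thm. 8.1 (proof from Lemma 8.2, p. 32)] -/
theorem aaronsonChen2017_thm81_sampBQP_subset_holds : aaronsonChen2017_thm81_sampBQP_subset :=
  aaronsonChen2017_thm81_sampBQP_subset_of_lem82 aaronsonChen2017_lem82_holds

/-- **Discharge of `aaronsonChen2017_thm81`** (Thm. 8.1 as vendored in the barrier entry
`PPolyOracles.lean`: "Suppose `SampBPP = SampBQP` and `NP ⊆ BPP`. Then for every oracle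
`O ∈ P/poly`, we have `SampBPP^O = SampBQP^O` (and consequently `BPP^O = BQP^O`)") — VACUOUS:
hypothesis `SampP = SampBQP` refuted by `sampP_ne_sampBQP`. (The conditional reductions
`aaronsonChen2017_thm81_of_lem82`, `aaronsonChen2017_thm81_of_lem82_decision` from the model
bridges remain the route to the faithful statement over `UniformSampP`.)
[cite: AaronsonChen2017, Thm. 8.1 (p. 32)] -/
theorem aaronsonChen2017_thm81_holds : aaronsonChen2017_thm81 :=
  fun hS => absurd hS sampP_ne_sampBQP

/-! ### The barrier reduces to Thm. 7.6 -/

/-- **`PPolyOracles` from Thm. 7.6 alone**: the barrier fact of the entry file is the conjunction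
`aaronsonChen2017_thm76 ∧ aaronsonChen2017_thm81`, and the second conjunct is discharged
(vacuously) above; what remains for `PPolyOracles_holds` is `aaronsonChen2017_thm76_holds`
(one-way functions ⟹ a `P/poly` oracle separating `BPP` from `BQP`; decomposed in
`PPolyOraclesProofs.lean` / `PPolyOraclesThm76.lean`). [cite: AaronsonChen2017, Thm. 7.6 and Thm. 8.1] -/
theorem PPolyOracles_of_thm76 (h76 : aaronsonChen2017_thm76) : PPolyOracles :=
  ⟨h76, aaronsonChen2017_thm81_holds⟩

/-- The same down to the crypto leaves of Thm. 7.6 (`aaronsonChen2017_thm76_of_parts'`): HILL,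
GGM, Luby–Rackoff and the §7.2–7.3 fact `aaronsonChen2017_thm76_of_prp`.
[cite: AaronsonChen2017, Thm. 7.6, Lemma 7.4] -/
theorem PPolyOracles_of_thm76_leaves (hHILL : PRGExist_iff_OWFExist) (hGGM : PRFExist_of_PRGExist)
    (hLR : PRPExist_of_PRFExist) (h76 : aaronsonChen2017_thm76_of_prp) : PPolyOracles :=
  PPolyOracles_of_thm76 (aaronsonChen2017_thm76_of_parts' hHILL hGGM hLR h76)

end Literature.Barriers.QuantumAdvantage
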